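import Summits.BirchSwinnertonDyer.Rank1Residual.GaloisImage.TameTorsionWitnesses
import Summits.BirchSwinnertonDyer.Rank1Residual.GaloisImage.TameTorsionValuationIIIstar
import HarnessLib

/-!
# Torsion witnesses on a Kodaira-`III*`-shaped integral model at `3` (cell `b2b-bsdres`, team
# n1011, seat p14 gen 2, OWNERS row T-b9 'tame tower at 3', step S6 inputs for `III*`)

HONEST FRAMING (cell `b2b-bsdres`, run/shared/lean/b2b/bsd-rank1-residual/, verbatim in every
file): the goal of the cell is to DELETE the COMBINATION-SHAPED residual classes of the
Birch–Swinnerton-Dyer formula for ALL analytic-rank `≤ 1` elliptic curves over `ℚ` — "full BSD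
formula for every rank `≤ 1` curve in class `C`" assembled STRICTLY from published theorems — so
that the rank-`≤ 1` remainder becomes exactly the CONSTRUCTION-SHAPED classes, which are TYPED
(missing-input `Prop`s), NOT attempted. This is not "finishing BSD". Team n1011 (N10 / N11, the
additive block X4 ∧ `p = 3`): research route on the CONSTRUCTION-SHAPED class X4; no claim beyond the
stated classes; nothing is booked. Theorems only (no definition, no named fact).

## What this file proves

The `III*` twin of `GaloisImage/TameTorsionWitnesses.lean`: for an integral equation `V` which is
**`III*`-shaped at `3`** (`9 ∣ b₂`, `27 ∥ b₄`, `3⁵ ∣ b₆` — a Kodaira-`III*` equation with its singular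
point at the origin) and elliptic over `ℚ`, on the geometric points of `V_ℚ`:

* `IIIstar.exists_nineTorsion_valuation_pow_27_eq` — CASE A′ (`9 ∥ b₂`): `∃ Q = (x, y)`, `9Q = O`,
  `x ≠ 0`, **`v(x)²⁷ = v(3)⁴⁰`**;
* `IIIstar.exists_threeTorsion_valuation_pow_4_eq` — CASE B′ (`27 ∣ b₂`): `∃ P = (ξ, η)`, `3P = O`,
  `ξ ≠ 0`, **`v(ξ)⁴ = v(3)⁵`**;
* `IIIstar.exists_nineTorsion_valuation_pow_36_eq` — CASE B′: `∃ Q`, `9Q = O`, `x ≠ 0`,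
  **`v(x)³⁶ = v(3)⁵³`**.

(`27, 40` and `36, 53` are coprime: the inertia criterion reads `27 ∣ e₉`, resp. `36 ∣ e₉` with
`4 ∣ e₃` from the `3`-torsion witness.)  Valuations from `TameTorsionValuationIIIstar` (the `III*`
case reduced to `III` by `⟨√3, 0, 0, 0⟩ • W`).  Step S6 inputs only; no tower claimed here.
-/

noncomputable section

open scoped Classical

open Polynomial WeierstrassCurve

namespace Summit.BirchSwinnertonDyer.Rank1Residual.GaloisImage

open Literature.NumberTheory.EllipticCurves

variable (V : WeierstrassCurve ℤ)

/-- An integer exactly divisible by `3ᵏ` has valuation `v(3)ᵏ`. [folklore] -/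
theorem valuation_intCast_eq_pow_of_dvd_of_not_dvd {n : ℤ} {k : ℕ} (h : (3 : ℤ) ^ k ∣ n)
    (h' : ¬ (3 : ℤ) ^ (k + 1) ∣ n) :
    (placeOver 3).valuation (n : AlgebraicClosure ℚ) =
      (placeOver 3).valuation (3 : AlgebraicClosure ℚ) ^ k := by
  obtain ⟨m, rfl⟩ := h
  have hm : ¬ (3 : ℤ) ∣ m := by
    rintro ⟨j, rfl⟩; exact h' ⟨j, by ring⟩
  push_cast
  rw [map_mul, map_pow, valuation_placeOver_intCast_eq_one 3 (by exact_mod_cast hm), mul_one]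

/-- Under `9 ∣ b₂`, `27 ∥ b₄`, `3⁵ ∣ b₆` one has `v(b₈) = v(3)⁶` (`4b₈ = b₂b₆ − b₄²`, the term `b₄²`
dominates). [folklore] -/
theorem valuation_b₈_eq_of_shape_IIIstar (hb2 : (9 : ℤ) ∣ V.b₂) (hb4 : (27 : ℤ) ∣ V.b₄)
    (hb4' : ¬ (81 : ℤ) ∣ V.b₄) (hb6 : (243 : ℤ) ∣ V.b₆) :
    (placeOver 3).valuation (V.b₈ : AlgebraicClosure ℚ) =
      (placeOver 3).valuation (3 : AlgebraicClosure ℚ) ^ 6 := by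
  set v := (placeOver 3).valuation with hv
  set t := v (3 : AlgebraicClosure ℚ) with ht
  have ht1 : t < 1 := valuation_three_lt_one
  have ht0 : t ≠ 0 := valuation_three_ne_zero
  have h4 : v (4 : AlgebraicClosure ℚ) = 1 := by
    have := valuation_placeOver_intCast_eq_one 3 (n := 4) (by norm_num)
    simpa using this
  have hb4v : v (V.b₄ : AlgebraicClosure ℚ) = t ^ 3 :=
    valuation_intCast_eq_pow_of_dvd_of_not_dvd (k := 3) (by norm_num; exact hb4) (by norm_num; exact hb4')
  have hb2v : v (V.b₂ : AlgebraicClosure ℚ) ≤ t ^ 2 :=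
    valuation_intCast_le_pow_of_dvd (n := V.b₂) (k := 2) (by norm_num; exact hb2)
  have hb6v : v (V.b₆ : AlgebraicClosure ℚ) ≤ t ^ 5 :=
    valuation_intCast_le_pow_of_dvd (n := V.b₆) (k := 5) (by norm_num; exact hb6)
  have hrel : (4 : AlgebraicClosure ℚ) * (V.b₈ : AlgebraicClosure ℚ) =
      -((V.b₄ : AlgebraicClosure ℚ) ^ 2) + (V.b₂ : AlgebraicClosure ℚ) * (V.b₆ : AlgebraicClosure ℚ) := by
    have := congrArg (fun z : ℤ ↦ (z : AlgebraicClosure ℚ)) V.b_relation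
    push_cast at this
    rw [this]; ring
  have hdom : v ((V.b₂ : AlgebraicClosure ℚ) * (V.b₆ : AlgebraicClosure ℚ)) <
      v (-((V.b₄ : AlgebraicClosure ℚ) ^ 2)) := by
    rw [Valuation.map_neg, map_pow, hb4v, map_mul, ← pow_mul]
    calc v (V.b₂ : AlgebraicClosure ℚ) * v (V.b₆ : AlgebraicClosure ℚ) ≤ t ^ 2 * t ^ 5 :=
          mul_le_mul' hb2v hb6v
      _ = t ^ 6 * t := by rw [← pow_add, ← pow_succ]
      _ < t ^ 6 * 1 := mul_lt_mul_left_of_ne_zero (pow_ne_zero 6 ht0) ht1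
      _ = t ^ (3 * 2) := by rw [mul_one]
  have h48 : v ((4 : AlgebraicClosure ℚ) * (V.b₈ : AlgebraicClosure ℚ)) = t ^ 6 := by
    rw [hrel, Valuation.map_add_eq_of_lt_left _ hdom, Valuation.map_neg, map_pow, hb4v, ← pow_mul]
  rwa [map_mul, h4, one_mul] at h48

/-- Valuation facts of the `III*`-shape, read in `ℚ̄`. [folklore] -/
theorem shape_valuations_IIIstar (hb2 : (9 : ℤ) ∣ V.b₂) (hb4 : (27 : ℤ) ∣ V.b₄)
    (hb4' : ¬ (81 : ℤ) ∣ V.b₄) (hb6 : (243 : ℤ) ∣ V.b₆) :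
    (placeOver 3).valuation (V.map (Int.castRingHom (AlgebraicClosure ℚ))).b₂ ≤
        (placeOver 3).valuation (3 : AlgebraicClosure ℚ) ^ 2 ∧
      (placeOver 3).valuation (V.map (Int.castRingHom (AlgebraicClosure ℚ))).b₄ =
        (placeOver 3).valuation (3 : AlgebraicClosure ℚ) ^ 3 ∧
      (placeOver 3).valuation (V.map (Int.castRingHom (AlgebraicClosure ℚ))).b₆ ≤
        (placeOver 3).valuation (3 : AlgebraicClosure ℚ) ^ 5 ∧
      (placeOver 3).valuation (V.map (Int.castRingHom (AlgebraicClosure ℚ))).b₈ =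
        (placeOver 3).valuation (3 : AlgebraicClosure ℚ) ^ 6 := by
  simp only [map_b₂, map_b₄, map_b₆, map_b₈, eq_intCast]
  exact ⟨valuation_intCast_le_pow_of_dvd (n := V.b₂) (k := 2) (by norm_num; exact hb2),
    valuation_intCast_eq_pow_of_dvd_of_not_dvd (k := 3) (by norm_num; exact hb4) (by norm_num; exact hb4'),
    valuation_intCast_le_pow_of_dvd (n := V.b₆) (k := 5) (by norm_num; exact hb6),
    valuation_b₈_eq_of_shape_IIIstar V hb2 hb4 hb4' hb6⟩

namespace IIIstar

/-- **`III*`, CASE A′ (`9 ∥ b₂`): a point `Q` with `9Q = O` and `v(x)²⁷ = v(3)⁴⁰`, `x ≠ 0`.**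
[folklore] -/
theorem exists_nineTorsion_valuation_pow_27_eq [hE : (V.map (Int.castRingHom ℚ)).IsElliptic]
    (hb2 : (9 : ℤ) ∣ V.b₂) (hb2' : ¬ (27 : ℤ) ∣ V.b₂) (hb4 : (27 : ℤ) ∣ V.b₄)
    (hb4' : ¬ (81 : ℤ) ∣ V.b₄) (hb6 : (243 : ℤ) ∣ V.b₆) :
    ∃ (Q : (V.map (Int.castRingHom ℚ)).geomPoints) (x y : AlgebraicClosure ℚ) (h : _),
      Q = .some x y h ∧ (9 : ℤ) • Q = 0 ∧ x ≠ 0 ∧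
        (placeOver 3).valuation x ^ 27 = (placeOver 3).valuation (3 : AlgebraicClosure ℚ) ^ 40 := by
  have h3K : (3 : AlgebraicClosure ℚ) ≠ 0 := by norm_num
  obtain ⟨hb2v, hb4v, hb6v, hb8v⟩ := shape_valuations_IIIstar V hb2 hb4 hb4' hb6
  have hb2e : (placeOver 3).valuation (V.map (Int.castRingHom (AlgebraicClosure ℚ))).b₂ =
      (placeOver 3).valuation (3 : AlgebraicClosure ℚ) ^ 2 := by
    simp only [map_b₂, eq_intCast]
    exact valuation_intCast_eq_pow_of_dvd_of_not_dvd (k := 2) (by norm_num; exact hb2)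
      (by norm_num; exact hb2')
  obtain ⟨ξ, hξ, hvξ⟩ := IIIstar.exists_isRoot_Ψ₃_valuation_pow_three_eq
    (V.map (Int.castRingHom (AlgebraicClosure ℚ))) hb2e hb4v hb6v hb8v
  have hξ' : (V.Ψ₃.map (Int.castRingHom (AlgebraicClosure ℚ))).IsRoot ξ := by rwa [← map_Ψ₃]
  obtain ⟨P, η, h, hP, hP3⟩ := exists_point_of_isRoot_Ψ₃ V hξ'
  obtain ⟨Q, x, y, h', hQ, hQ9, hrel⟩ := exists_nineTorsion_over V hP hP3
  have hξ1 := IIIstar.valuation_le_of_isRoot_Ψ₃ (V.map (Int.castRingHom (AlgebraicClosure ℚ)))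
    hb2v hb4v.le hb6v hb8v.le hξ
  have hrel' : ξ * ((V.map (Int.castRingHom (AlgebraicClosure ℚ))).Ψ₃.eval x) ^ 2 =
      ((V.map (Int.castRingHom (AlgebraicClosure ℚ))).Φ 3).eval x := by
    rw [map_Ψ₃, map_Φ]; exact hrel
  have h9 := IIIstar.valuation_pow_nine_eq_of_mul_rel (V.map (Int.castRingHom (AlgebraicClosure ℚ)))
    hb2v hb4v.le hb6v hb8v hrel' hξ1 hvξ.symm.le
  set v := (placeOver 3).valuation with hv
  set t := v (3 : AlgebraicClosure ℚ) with ht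
  have ht0 : t ≠ 0 := valuation_three_ne_zero
  have h27 : v x ^ 27 = t ^ 40 := by
    calc v x ^ 27 = (v x ^ 9) ^ 3 := by rw [← pow_mul]
      _ = (v ξ * t ^ 12) ^ 3 := by rw [h9]
      _ = v ξ ^ 3 * t ^ 36 := by rw [mul_pow, ← pow_mul]
      _ = t ^ 4 * t ^ 36 := by rw [hvξ]
      _ = t ^ 40 := by rw [← pow_add]
  refine ⟨Q, x, y, h', hQ, hQ9, ?_, h27⟩
  intro hx0
  rw [hx0, map_zero, zero_pow (by norm_num)] at h27
  exact pow_ne_zero 40 ht0 h27.symm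

/-- **`III*`, CASE B′ (`27 ∣ b₂`): a point `P` of order `3` with `v(ξ)⁴ = v(3)⁵`, `ξ ≠ 0`.**
[folklore] -/
theorem exists_threeTorsion_valuation_pow_4_eq [hE : (V.map (Int.castRingHom ℚ)).IsElliptic]
    (hb2 : (27 : ℤ) ∣ V.b₂) (hb4 : (27 : ℤ) ∣ V.b₄) (hb4' : ¬ (81 : ℤ) ∣ V.b₄)
    (hb6 : (243 : ℤ) ∣ V.b₆) :
    ∃ (P : (V.map (Int.castRingHom ℚ)).geomPoints) (ξ η : AlgebraicClosure ℚ) (h : _),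
      P = .some ξ η h ∧ (3 : ℤ) • P = 0 ∧ ξ ≠ 0 ∧
        (placeOver 3).valuation ξ ^ 4 = (placeOver 3).valuation (3 : AlgebraicClosure ℚ) ^ 5 := by
  have ht0 : (placeOver 3).valuation (3 : AlgebraicClosure ℚ) ≠ 0 := valuation_three_ne_zero
  have hb2' : (9 : ℤ) ∣ V.b₂ := dvd_trans ⟨3, by norm_num⟩ hb2
  obtain ⟨-, hb4v, hb6v, hb8v⟩ := shape_valuations_IIIstar V hb2' hb4 hb4' hb6
  have hb2v : (placeOver 3).valuation (V.map (Int.castRingHom (AlgebraicClosure ℚ))).b₂ ≤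
      (placeOver 3).valuation (3 : AlgebraicClosure ℚ) ^ 3 := by
    simp only [map_b₂, eq_intCast]
    exact valuation_intCast_le_pow_of_dvd (n := V.b₂) (k := 3) (by norm_num; exact hb2)
  -- a root of `ψ₃` (degree 4) in `ℚ̄`
  set F := V.Ψ₃.map (Int.castRingHom (AlgebraicClosure ℚ)) with hF
  have hdeg : F.natDegree = 4 := by
    rw [hF, natDegree_map_eq_of_injective (Int.castRingHom (AlgebraicClosure ℚ)).injective_int]
    exact V.natDegree_Ψ₃ (by norm_num)
  obtain ⟨ξ, hξ⟩ := IsAlgClosed.exists_root F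
    (by rw [degree_eq_natDegree (by rintro h0; rw [h0, natDegree_zero] at hdeg; exact absurd hdeg (by norm_num)), hdeg]; norm_num)
  obtain ⟨P, η, h, hP, hP3⟩ := exists_point_of_isRoot_Ψ₃ V hξ
  have hξW : (V.map (Int.castRingHom (AlgebraicClosure ℚ))).Ψ₃.IsRoot ξ := by rwa [map_Ψ₃]
  have hv4 := IIIstar.valuation_pow_four_eq_of_isRoot_Ψ₃ (V.map (Int.castRingHom (AlgebraicClosure ℚ)))
    hb2v hb4v hb6v hb8v hξW
  refine ⟨P, ξ, η, h, hP, hP3, ?_, hv4⟩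
  intro hx0
  rw [hx0, map_zero, zero_pow (by norm_num)] at hv4
  exact pow_ne_zero 5 ht0 hv4.symm

/-- **`III*`, CASE B′ (`27 ∣ b₂`): a point `Q` with `9Q = O` and `v(x)³⁶ = v(3)⁵³`, `x ≠ 0`.**
[folklore] -/
theorem exists_nineTorsion_valuation_pow_36_eq [hE : (V.map (Int.castRingHom ℚ)).IsElliptic]
    (hb2 : (27 : ℤ) ∣ V.b₂) (hb4 : (27 : ℤ) ∣ V.b₄) (hb4' : ¬ (81 : ℤ) ∣ V.b₄)
    (hb6 : (243 : ℤ) ∣ V.b₆) :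
    ∃ (Q : (V.map (Int.castRingHom ℚ)).geomPoints) (x y : AlgebraicClosure ℚ) (h : _),
      Q = .some x y h ∧ (9 : ℤ) • Q = 0 ∧ x ≠ 0 ∧
        (placeOver 3).valuation x ^ 36 = (placeOver 3).valuation (3 : AlgebraicClosure ℚ) ^ 53 := by
  have hb2' : (9 : ℤ) ∣ V.b₂ := dvd_trans ⟨3, by norm_num⟩ hb2
  obtain ⟨hb2v, hb4v, hb6v, hb8v⟩ := shape_valuations_IIIstar V hb2' hb4 hb4' hb6
  obtain ⟨P, ξ, η, h, hP, hP3, hξ0, hvξ⟩ :=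
    IIIstar.exists_threeTorsion_valuation_pow_4_eq V hb2 hb4 hb4' hb6
  obtain ⟨Q, x, y, h', hQ, hQ9, hrel⟩ := exists_nineTorsion_over V hP hP3
  -- `P`'s abscissa is a root of `ψ₃`
  have hξroot : (V.map (Int.castRingHom (AlgebraicClosure ℚ))).Ψ₃.IsRoot ξ := by
    have e := baseChange_map_intCast_eq V
    have h0 := (zsmul_some_eq_zero_iff_eval_ΨSq _ h 3).mp (by rw [← hP]; exact hP3)
    rw [e, ΨSq_three, eval_pow] at h0
    exact (pow_eq_zero_iff two_ne_zero).mp h0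
  have hξ1 := IIIstar.valuation_le_of_isRoot_Ψ₃ (V.map (Int.castRingHom (AlgebraicClosure ℚ)))
    hb2v hb4v.le hb6v hb8v.le hξroot
  set v := (placeOver 3).valuation with hv
  set t := v (3 : AlgebraicClosure ℚ) with ht
  have ht0 : t ≠ 0 := valuation_three_ne_zero
  have hξ3 : t ^ 4 ≤ v ξ ^ 3 := by
    -- `t⁵ = v ξ⁴ = v ξ³ · v ξ ≤ v ξ³ · t`
    have : t ^ 4 * t ≤ v ξ ^ 3 * t := by
      calc t ^ 4 * t = t ^ 5 := by rw [← pow_succ]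
        _ = v ξ ^ 3 * v ξ := by rw [← hvξ, ← pow_succ]
        _ ≤ v ξ ^ 3 * t := mul_le_mul' le_rfl hξ1
    exact le_of_mul_le_mul_right this (zero_lt_iff.mpr ht0)
  have hrel' : ξ * ((V.map (Int.castRingHom (AlgebraicClosure ℚ))).Ψ₃.eval x) ^ 2 =
      ((V.map (Int.castRingHom (AlgebraicClosure ℚ))).Φ 3).eval x := by
    rw [map_Ψ₃, map_Φ]; exact hrel
  have h9 := IIIstar.valuation_pow_nine_eq_of_mul_rel (V.map (Int.castRingHom (AlgebraicClosure ℚ)))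
    hb2v hb4v.le hb6v hb8v hrel' hξ1 hξ3
  have h36 : v x ^ 36 = t ^ 53 := by
    calc v x ^ 36 = (v x ^ 9) ^ 4 := by rw [← pow_mul]
      _ = (v ξ * t ^ 12) ^ 4 := by rw [h9]
      _ = v ξ ^ 4 * t ^ 48 := by rw [mul_pow, ← pow_mul]
      _ = t ^ 5 * t ^ 48 := by rw [hvξ]
      _ = t ^ 53 := by rw [← pow_add]
  refine ⟨Q, x, y, h', hQ, hQ9, ?_, h36⟩
  intro hx0
  rw [hx0, map_zero, zero_pow (by norm_num)] at h36
  exact pow_ne_zero 53 ht0 h36.symm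

end IIIstar

end Summit.BirchSwinnertonDyer.Rank1Residual.GaloisImage

end
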